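import Summits.HodgeConjecture.CorCM.StabiliserOrbitSelfConjugateCMFields
import HarnessLib

/-!
# Self-conjugate stabiliser orbits and AUTOMORPHISMS: (SC) forces `Aut(K) = {1, ρ}`, and for a CM field whose maximal
# real subfield is Galois over `ℚ` the converse holds — every CM type of such a field is nondegenerate

COR-CM (cell `pub-hodgecm2`, binder seat `b16` gen 54, count-neutral claim STAB-CONJ, file F5; theorems only, no definition,
no named fact, no `sorry`).  NEW as stated, hence under `Summits/`.  HONEST FRAMING: statements about CM types of ONE CM
field and products of CM abelian varieties with complex multiplication by it; `HC_CM` is neither used nor asserted — «HC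
for NAMED classes».

F1/F2 (`StabiliserOrbitSelfConjugate`, `…CMFields`): the hypothesis

  (SC)  `∀ x₀ x : K → ℂ, x ∉ {x₀, x̄₀} → ∃ σ ∈ Aut(ℂ), σ ∘ x₀ = x₀ ∧ σ ∘ x = x̄`

is equivalent to multiplicity one of the odd weights and makes every CM type of `K` nondegenerate.  This file reads (SC)
on the AUTOMORPHISM GROUP of `K`:

* §1 **`apply_eq_or_eq_complexConj_of_stabConj`** — (SC) ⟹ `Aut(K) = {1, ρ}`: every ring automorphism of `K` is the
  identity or complex conjugation (an automorphism `α` gives the embedding `x₀ ∘ α` with the SAME image as `x₀`; an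
  element of `Aut(ℂ)` fixing `x₀(K)` pointwise cannot conjugate it).  A NECESSARY condition for (SC) with no hypothesis:
  Galois CM fields of degree `≥ 4`, and more generally CM fields with an extra automorphism, never satisfy (SC); nor do
  CM fields receiving a totally complex field of smaller degree (`not_stabConj_of_ringHom_of_finrank_lt`: two embeddings
  agreeing on it cannot be separated) — an (SC) field has NO proper CM subfield.
* §2 **`stabConj_of_forall_ringEquiv`** — THE CONVERSE when `K⁺ = maximalRealSubfield K` is GALOIS over `ℚ`: then
  `x(K⁺) = x₀(K⁺)` for all embeddings, the field test of F2 (`x₀(K) ⊄ x(K)·x₀(K⁺) = x(K)`) reduces to `x(K) ≠ x₀(K)`, and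
  `x(K) = x₀(K)` would produce the automorphism `x₀⁻¹ ∘ x ∉ {1, ρ}`.  So for `K⁺` Galois:
  **(SC) ⟺ `Aut(K) = {1, ρ}`** (`stabConj_iff_forall_ringEquiv`).  In Kummer terms, `K = K⁺(√−δ)`: no
  `τ ∈ Gal(K⁺/ℚ) ∖ {1}` has `δ/τδ ∈ (K⁺)²` — only PAIRWISE conditions on the conjugates of `δ`, against the full
  independence of pair flips (`[Kᶜ:ℚ] = 2ⁿ·n`) or the corank-one condition of double flips: e.g. `K⁺` real cyclic sextic
  and `δ·σ²δ·σ⁴δ ∈ (K⁺)²` with `δ/σ^kδ ∉ (K⁺)²` (`[Kᶜ:ℚ] = 96`, no double flip at adjacent places) is (SC), not covered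
  before.
* §3 consequences for `K⁺` Galois and `Aut(K) = {1, ρ}`: **`isNondegenerate_of_forall_ringEquiv`** (EVERY CM type is
  nondegenerate: `B• = D•` on all powers of every abelian variety with CM by `K`, which is simple —
  `isSimple_of_forall_ringEquiv`), **`isNondegenerateFamily_iff_linearIndependent_of_forall_ringEquiv`**,
  **`hodgeConjectureFor_prod_of_card_le_three_of_forall_ringEquiv`** (the Hodge conjecture on all products of up to
  three pairwise non-isogenous such varieties, UNCONDITIONALLY), and — via F3 — all two-slot criteria against any partner.
* §4 `stabConj_of_transitive`, `isNondegenerate_of_transitive` — if `Aut(ℂ / x₀K)` is TRANSITIVE on the other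
  `[K:ℚ] − 2` embeddings (the minimal polynomial of a generator splits off only `(T − θ)(T − θ̄)` over `K`), (SC) holds:
  e.g. octic CM fields with Galois group `GL₂(𝔽₃)` on `𝔽₃² ∖ 0` (sign group `{1, ρ}` — no flip of any kind, no CM
  subfield; the seat's GAP census of the 38 octic CM Galois types finds (SC) in exactly 19 of them: the 16 with pair or
  double flips, two of order 32 with sign group of order 4, and `GL₂(𝔽₃)`).

## References

* [Shimura1998] G. Shimura, *Abelian Varieties with Complex Multiplication and Modular Functions*, §8.2 Prop. 26, §18.2.
* [Lang2002] S. Lang, *Algebra*, 3rd ed., V §2 Thm. 2.8, VI §1 Thm. 1.12, VI §8 (Kummer theory).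
* [Dodson1984] B. Dodson, *The structure of Galois groups of CM-fields*, Trans. AMS 283 (1984), §1.1, §2.
* [Gordon1999HodgeAVSurvey] B. B. Gordon, *A survey of the Hodge conjecture for abelian varieties*, §3, 7.5–7.7, 10.10.
-/

set_option autoImplicit false

noncomputable section

open CategoryTheory CategoryTheory.Limits NumberField

namespace Summit.HodgeConjecture.CorCM

open Literature.NumberTheory.ComplexMultiplication
open Literature.AlgebraicGeometry.Motives (AbelianVariety CMType)
open Literature.AlgebraicGeometry.HodgeTheory
open Literature.AlgebraicGeometry.ComplexMultiplication (IsCMTypeRealisation)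
open Literature.AlgebraicGeometry.VanGeemen1994 (hodgeClassSpan)
open Literature.AlgebraicGeometry.Pohlmann1968
open Literature.Barriers.HodgeConjecture (divisorClassesSpan)
open GenericCMField

variable {K : Type} [Field K] [NumberField K] [IsCMField K]

/-! ## §1 (SC) forces `Aut(K) = {1, ρ}` -/

section Necessary

/-- **(SC) ⟹ `Aut(K) = {1, ρ}`**: under (SC) every ring automorphism of the CM field `K` is the identity or complex
conjugation (the embedding `x₀ ∘ α` has the same image as `x₀`, so an automorphism of `ℂ` fixing `x₀(K)` pointwise
fixes it instead of conjugating it). [cite: Shimura1998, §18.2 Lemma] -/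
theorem apply_eq_or_eq_complexConj_of_stabConj
    (hSC : ∀ x₀ x : K →+* ℂ, x ≠ x₀ → x ≠ (starRingAut : ℂ ≃+* ℂ) • x₀ →
      ∃ σ : ℂ ≃+* ℂ, σ • x₀ = x₀ ∧ σ • x = (starRingAut : ℂ ≃+* ℂ) • x)
    (α : K ≃+* K) : (∀ w, α w = w) ∨ ∀ w, α w = IsCMField.complexConj K w := by
  obtain ⟨x₀⟩ : Nonempty (K →+* ℂ) := inferInstance
  set x : K →+* ℂ := x₀.comp α.toRingHom with hx_def
  have hx : ∀ w, x w = x₀ (α w) := fun w => rfl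
  by_cases h₁ : x = x₀
  · left
    intro w
    exact x₀.injective (by rw [← hx, h₁])
  by_cases h₂ : x = (starRingAut : ℂ ≃+* ℂ) • x₀
  · right
    intro w
    apply x₀.injective
    rw [← hx, h₂, ringEquiv_smul_apply, starRingAut_apply, IsCMField.complexEmbedding_complexConj]
    rfl
  exfalso
  obtain ⟨σ, hσ₀, hσx⟩ := hSC x₀ x h₁ h₂
  -- `σ` fixes `x = x₀ ∘ α` pointwise, yet conjugates it
  have hfix : σ • x = x := RingHom.ext fun w => by
    rw [ringEquiv_smul_apply, hx, ← ringEquiv_smul_apply σ x₀ (α w), hσ₀]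
  rw [hfix] at hσx
  exact conj_smul_ne x hσx.symm

/-- **(SC) ⟹ only two automorphisms**: `K` has no ring automorphism besides `1` and complex conjugation; in particular a
Galois CM field of degree `≥ 4`, or any CM field with a third automorphism, is never (SC). [cite: Shimura1998, §18.2 Lemma] -/
theorem not_stabConj_of_ringEquiv (α : K ≃+* K) (h₁ : ∃ w, α w ≠ w) (h₂ : ∃ w, α w ≠ IsCMField.complexConj K w) :
    ¬ ∀ x₀ x : K →+* ℂ, x ≠ x₀ → x ≠ (starRingAut : ℂ ≃+* ℂ) • x₀ →
      ∃ σ : ℂ ≃+* ℂ, σ • x₀ = x₀ ∧ σ • x = (starRingAut : ℂ ≃+* ℂ) • x := fun hSC => by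
  obtain ⟨w₁, hw₁⟩ := h₁
  obtain ⟨w₂, hw₂⟩ := h₂
  rcases apply_eq_or_eq_complexConj_of_stabConj hSC α with h | h
  · exact hw₁ (h w₁)
  · exact hw₂ (h w₂)

omit [IsCMField K] in
/-- **(SC) ⟹ no proper CM (indeed no totally complex) subfield.**  If a totally complex number field `E` of smaller
degree embeds in `K`, two distinct embeddings `x₀ ≠ x` of `K` agree on `E` (pigeonhole); `x ≠ x̄₀` since `x|_E` is not
real; an automorphism of `ℂ` fixing `x₀` fixes `x|_E = x₀|_E`, so it cannot conjugate `x`.  In particular an (SC) field has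
no imaginary quadratic subfield and every CM type of it is primitive. [cite: Shimura1998, §8.2 Prop. 26 and §18.2 Lemma] -/
theorem not_stabConj_of_ringHom_of_finrank_lt {E : Type} [Field E] [NumberField E] [IsTotallyComplex E] (e : E →+* K)
    (hlt : Module.finrank ℚ E < Module.finrank ℚ K) :
    ¬ ∀ x₀ x : K →+* ℂ, x ≠ x₀ → x ≠ (starRingAut : ℂ ≃+* ℂ) • x₀ →
      ∃ σ : ℂ ≃+* ℂ, σ • x₀ = x₀ ∧ σ • x = (starRingAut : ℂ ≃+* ℂ) • x := by
  intro hSC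
  -- two embeddings of `K` with the same restriction to `E`
  have hcard : Fintype.card (E →+* ℂ) < Fintype.card (K →+* ℂ) := by
    rw [Embeddings.card E ℂ, Embeddings.card K ℂ]
    exact hlt
  obtain ⟨x₀, x, hne, hres⟩ := Fintype.exists_ne_map_eq_of_card_lt (fun y : K →+* ℂ => y.comp e) hcard
  have hres' : ∀ w, x₀ (e w) = x (e w) := fun w => congrArg (fun f : E →+* ℂ => f w) hres
  have hreal : ∀ y : K →+* ℂ, (starRingAut : ℂ ≃+* ℂ) • (y.comp e) ≠ y.comp e := fun y h => by
    rw [conj_smul_eq_conjugate] at h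
    exact IsTotallyComplex.complexEmbedding_not_isReal (y.comp e) (ComplexEmbedding.isReal_iff.2 h)
  have hx' : x ≠ (starRingAut : ℂ ≃+* ℂ) • x₀ := by
    intro h
    apply hreal x₀
    refine RingHom.ext fun w => ?_
    rw [ringEquiv_smul_apply, RingHom.comp_apply]
    have h1 : x (e w) = starRingAut (x₀ (e w)) := by rw [h, ringEquiv_smul_apply]
    rw [← h1, ← hres' w]
  obtain ⟨σ, hσ₀, hσx⟩ := hSC x₀ x hne.symm hx'
  apply hreal x
  refine RingHom.ext fun w => ?_
  rw [ringEquiv_smul_apply, RingHom.comp_apply]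
  have h1 : starRingAut (x (e w)) = σ (x (e w)) := by
    rw [← ringEquiv_smul_apply σ x (e w), hσx, ringEquiv_smul_apply]
  have h2 : σ (x₀ (e w)) = x₀ (e w) := by rw [← ringEquiv_smul_apply σ x₀ (e w), hσ₀]
  rw [h1, ← hres' w, h2]

end Necessary

/-! ## §2 `K⁺` Galois: `Aut(K) = {1, ρ}` ⟹ (SC) -/

section Sufficient

/-- Two `ℚ`-embeddings of a normal extension into any field have the same image (copy of the tree's
`fieldRange_eq_fieldRange_of_normal`, kept local to spare the import). [folklore] -/
private theorem fieldRange_eq_fieldRange_of_normal₅₄ {F L M : Type*} [Field F] [Field L] [Field M]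
    [Algebra F L] [Algebra F M] [Normal F L] (f g : L →ₐ[F] M) : f.fieldRange = g.fieldRange := by
  have key : ∀ f g : L →ₐ[F] M, g.fieldRange ≤ f.fieldRange := by
    intro f g
    haveI : Normal F f.fieldRange := Normal.of_algEquiv f.equivFieldRange
    have h := AlgHom.fieldRange_of_normal (g.comp f.equivFieldRange.symm.toAlgHom)
    intro z hz
    obtain ⟨x, rfl⟩ := AlgHom.mem_fieldRange.1 hz
    rw [← h]
    exact ⟨f.equivFieldRange x, by simp⟩
  exact le_antisymm (key g f) (key f g)

omit [IsCMField K] in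
/-- **Same image ⟹ differ by an automorphism**: if two embeddings `x₀, x : K → ℂ` have `x₀(K) ⊆ x(K)`, then
`x = x₀ ∘ α` for a ring automorphism `α` of `K`. [cite: Lang2002, V §2 Thm. 2.8] -/
theorem exists_ringEquiv_comp_eq_of_fieldRange_le (x₀ x : K →+* ℂ)
    (hle : x₀.toRatAlgHom.fieldRange ≤ x.toRatAlgHom.fieldRange) :
    ∃ α : K ≃+* K, ∀ w, x₀ (α w) = x w := by
  haveI : FiniteDimensional ℚ x.toRatAlgHom.fieldRange :=
    LinearEquiv.finiteDimensional x.toRatAlgHom.equivFieldRange.toLinearEquiv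
  have heq : x₀.toRatAlgHom.fieldRange = x.toRatAlgHom.fieldRange :=
    IntermediateField.eq_of_le_of_finrank_eq hle
      (by rw [← x₀.toRatAlgHom.equivFieldRange.toLinearEquiv.finrank_eq,
        ← x.toRatAlgHom.equivFieldRange.toLinearEquiv.finrank_eq])
  let β : K ≃ₐ[ℚ] K :=
    x.toRatAlgHom.equivFieldRange.trans
      ((IntermediateField.equivOfEq heq.symm).trans x₀.toRatAlgHom.equivFieldRange.symm)
  refine ⟨β.toRingEquiv, fun w => ?_⟩
  -- `x₀ (β w) = x w`: unfold the three isomorphisms on the values in `ℂ`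
  have h1 : ((x₀.toRatAlgHom.equivFieldRange (β w) : x₀.toRatAlgHom.fieldRange) : ℂ) = x₀ (β w) :=
    AlgHom.equivFieldRange_apply_coe _ _
  have h2 : x₀.toRatAlgHom.equivFieldRange (β w) =
      IntermediateField.equivOfEq heq.symm (x.toRatAlgHom.equivFieldRange w) := by
    simp only [β, AlgEquiv.trans_apply, AlgEquiv.apply_symm_apply]
  have h3 : ((IntermediateField.equivOfEq heq.symm (x.toRatAlgHom.equivFieldRange w) :
      x₀.toRatAlgHom.fieldRange) : ℂ) = x w := by
    rw [IntermediateField.equivOfEq_apply, AlgHom.equivFieldRange_apply_coe]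
    rfl
  change x₀ (β w) = x w
  rw [← h1, h2, h3]

/-- **`K⁺` Galois and `Aut(K) = {1, ρ}` ⟹ (SC).**  If the maximal real subfield of `K` is normal over `ℚ` and every ring
automorphism of `K` is the identity or complex conjugation, then for all embeddings `x₀` and `x ∉ {x₀, x̄₀}` some
automorphism of `ℂ` fixes `x₀` and conjugates `x` (F2's field test: `x(K)·x₀(K⁺) = x(K) ⊉ x₀(K)`, else `x = x₀ ∘ α`).
[cite: Lang2002, V §2 Thm. 2.8 and VI §1 Thm. 1.12] [cite: Shimura1998, §18.2 Lemma] -/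
theorem stabConj_of_forall_ringEquiv [Normal ℚ (maximalRealSubfield K)]
    (hAut : ∀ α : K ≃+* K, (∀ w, α w = w) ∨ ∀ w, α w = IsCMField.complexConj K w)
    (x₀ x : K →+* ℂ) (hx : x ≠ x₀) (hx' : x ≠ (starRingAut : ℂ ≃+* ℂ) • x₀) :
    ∃ σ : ℂ ≃+* ℂ, σ • x₀ = x₀ ∧ σ • x = (starRingAut : ℂ ≃+* ℂ) • x := by
  rw [stabConj_at_iff_not_le]
  intro hle
  -- `x₀(K⁺) = x(K⁺) ≤ x(K)` since `K⁺/ℚ` is normal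
  have hreal : (x₀.comp (maximalRealSubfield K).subtype).toRatAlgHom.fieldRange ≤ x.toRatAlgHom.fieldRange := by
    rw [fieldRange_eq_fieldRange_of_normal₅₄ (x₀.comp (maximalRealSubfield K).subtype).toRatAlgHom
      (x.comp (maximalRealSubfield K).subtype).toRatAlgHom]
    rintro _ ⟨⟨r, hr⟩, rfl⟩
    exact ⟨r, rfl⟩
  have hle' : x₀.toRatAlgHom.fieldRange ≤ x.toRatAlgHom.fieldRange := hle.trans (sup_le le_rfl hreal)
  obtain ⟨α, hα⟩ := exists_ringEquiv_comp_eq_of_fieldRange_le x₀ x hle'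
  rcases hAut α with h | h
  · exact hx (RingHom.ext fun w => by rw [← hα, h])
  · refine hx' (RingHom.ext fun w => ?_)
    rw [← hα, h, ringEquiv_smul_apply, starRingAut_apply, IsCMField.complexEmbedding_complexConj]
    rfl

/-- **For `K⁺` Galois: (SC) ⟺ `Aut(K) = {1, ρ}`.** [cite: Lang2002, VI §1 Thm. 1.12] [cite: Shimura1998, §18.2 Lemma] -/
theorem stabConj_iff_forall_ringEquiv [Normal ℚ (maximalRealSubfield K)] :
    (∀ x₀ x : K →+* ℂ, x ≠ x₀ → x ≠ (starRingAut : ℂ ≃+* ℂ) • x₀ →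
      ∃ σ : ℂ ≃+* ℂ, σ • x₀ = x₀ ∧ σ • x = (starRingAut : ℂ ≃+* ℂ) • x) ↔
    ∀ α : K ≃+* K, (∀ w, α w = w) ∨ ∀ w, α w = IsCMField.complexConj K w :=
  ⟨apply_eq_or_eq_complexConj_of_stabConj, stabConj_of_forall_ringEquiv⟩

end Sufficient

/-! ## §3 Consequences: CM fields with Galois real subfield and only two automorphisms -/

section Consequences

variable [Normal ℚ (maximalRealSubfield K)]

/-- **`K⁺` Galois, `Aut(K) = {1, ρ}`: EVERY CM type of `K` is nondegenerate** (`dim MT(A_Φ) = dim A_Φ + 1`, `B• = D•` on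
all powers of `A_Φ`, the Hodge conjecture for everything isogenous to a power). [cite: Shimura1998, §8.2 Prop. 26]
[cite: Gordon1999HodgeAVSurvey, 7.5–7.6] -/
theorem isNondegenerate_of_forall_ringEquiv
    (hAut : ∀ α : K ≃+* K, (∀ w, α w = w) ∨ ∀ w, α w = IsCMField.complexConj K w) (Φ : CMType K) :
    IsNondegenerate Φ :=
  isNondegenerate_of_stabConj (stabConj_of_forall_ringEquiv hAut) Φ

/-- **… and every abelian variety with complex multiplication by `K` is simple.** [cite: Shimura1998, §8.2 Prop. 26] -/
theorem isSimple_of_forall_ringEquiv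
    (hAut : ∀ α : K ≃+* K, (∀ w, α w = w) ∨ ∀ w, α w = IsCMField.complexConj K w)
    {Φ : CMType K} {A : AbelianVariety ℂ} {ι : 𝓞 K →+* End A} {θ : K →+* Module.End ℂ (complexBetti A.X 1)}
    (hA : IsCMTypeRealisation Φ A ι θ) : A.IsSimple :=
  isSimple_of_stabConj (stabConj_of_forall_ringEquiv hAut) hA

variable {I : Type} [Fintype I] [Nonempty I] {Φ : I → CMType K} {A : I → AbelianVariety ℂ}
  {ι : ∀ i, 𝓞 K →+* End (A i)} {θ : ∀ i, K →+* Module.End ℂ (complexBetti (A i).X 1)}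

/-- **`K⁺` Galois, `Aut(K) = {1, ρ}`: a family of CM types of `K` is nondegenerate ⟺ its type vectors are linearly
independent.** [cite: Gordon1999HodgeAVSurvey, 7.5–7.7] -/
theorem isNondegenerateFamily_iff_linearIndependent_of_forall_ringEquiv
    (hAut : ∀ α : K ≃+* K, (∀ w, α w = w) ∨ ∀ w, α w = IsCMField.complexConj K w) (Φ : I → CMType K) :
    CMAlgebra.IsNondegenerateFamily (K := fun _ : I => K) Φ ↔
      LinearIndependent ℚ fun i => antiVec (Φ i).1 (1 : ℂ ≃+* ℂ) :=
  isNondegenerateFamily_iff_linearIndependent_of_stabConj (stabConj_of_forall_ringEquiv hAut) Φ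

/-- **`K⁺` Galois, `Aut(K) = {1, ρ}`: the Hodge conjecture on every product `⨁_{j<N} A_{π j}` of at most three pairwise
non-isogenous abelian varieties with complex multiplication by `K`** (with `B• = D•` there), UNCONDITIONALLY.
[cite: Gordon1999HodgeAVSurvey, 7.5 and 10.10] -/
theorem hodgeConjectureFor_prod_of_card_le_three_of_forall_ringEquiv
    (hAut : ∀ α : K ≃+* K, (∀ w, α w = w) ∨ ∀ w, α w = IsCMField.complexConj K w)
    (hA : ∀ i, IsCMTypeRealisation (Φ i) (A i) (ι i) (θ i))
    (hniso : ∀ i j, i ≠ j → ¬AbelianVariety.IsIsogenous (A i) (A j)) (hcard : Fintype.card I ≤ 3)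
    {N : ℕ} (π : Fin N → I) :
    HodgeConjectureFor (⨁ fun j : Fin N => A (π j)).dim (⨁ fun j : Fin N => A (π j)).X ∧
      ∀ m : ℕ, hodgeClassSpan (⨁ fun j : Fin N => A (π j)).dim (⨁ fun j : Fin N => A (π j)).X m =
        divisorClassesSpan (⨁ fun j : Fin N => A (π j)).X (⨁ fun j : Fin N => A (π j)).dim m :=
  ⟨hodgeConjectureFor_prod_of_card_le_three_of_stabConj (stabConj_of_forall_ringEquiv hAut) hA hniso hcard π,
    fun m => hodgeClassSpan_prod_eq_of_card_le_three_of_stabConj (stabConj_of_forall_ringEquiv hAut) hA hniso hcard π m⟩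

/-- **`K⁺` Galois, `Aut(K) = {1, ρ}`: more than `[K:ℚ]/2` pairwise non-isogenous abelian varieties with CM by `K` carry
an exceptional Hodge class on some product.** [cite: Gordon1999HodgeAVSurvey, 7.6.1 and 7.7] -/
theorem exists_exceptional_prod_of_lt_card_of_forall_ringEquiv
    (hAut : ∀ α : K ≃+* K, (∀ w, α w = w) ∨ ∀ w, α w = IsCMField.complexConj K w)
    (hA : ∀ i, IsCMTypeRealisation (Φ i) (A i) (ι i) (θ i))
    (hniso : ∀ i j, i ≠ j → ¬AbelianVariety.IsIsogenous (A i) (A j))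
    (hcard : Module.finrank ℚ K / 2 < Fintype.card I) :
    ∃ (N : ℕ) (π : Fin N → I) (m : ℕ) (c : complexBetti (⨁ fun j : Fin N => A (π j)).X (2 * m)),
      IsRationalClass c ∧
      IsOfHodgeType (⨁ fun j : Fin N => A (π j)).dim (⨁ fun j : Fin N => A (π j)).X (2 * m) m m c ∧
      c ∉ divisorClassesSpan (⨁ fun j : Fin N => A (π j)).X (⨁ fun j : Fin N => A (π j)).dim m :=
  exists_exceptional_prod_of_lt_card_of_stabConj (stabConj_of_forall_ringEquiv hAut) hA hniso hcard

end Consequences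

/-! ## §4 Stabilisers transitive off the base pair -/

section Transitive

omit [NumberField K] [IsCMField K] in
/-- **Transitive stabilisers ⟹ (SC).**  If for one embedding `x₀` the automorphisms of `ℂ` fixing `x₀` act TRANSITIVELY
on the other `[K:ℚ] − 2` embeddings (off `{x₀, x̄₀}`) — for `K = ℚ(θ)`: the minimal polynomial of `θ` factors over `K`
as `(T − θ)(T − θ̄)·g(T)` with `g` IRREDUCIBLE over `K` — then (SC) holds at `x₀` (the single orbit contains `x̄` with
`x`).  E.g. octic CM fields with Galois group `GL₂(𝔽₃)` acting on `𝔽₃² ∖ 0` (sign group `{1, ρ}`, no pair or double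
flip, no CM subfield). [cite: Wielandt1964, §16 and Thm. 28.4] -/
theorem stabConj_at_of_transitive {x₀ : K →+* ℂ}
    (htr : ∀ x x' : K →+* ℂ, x ≠ x₀ → x ≠ (starRingAut : ℂ ≃+* ℂ) • x₀ → x' ≠ x₀ →
      x' ≠ (starRingAut : ℂ ≃+* ℂ) • x₀ → ∃ σ : ℂ ≃+* ℂ, σ • x₀ = x₀ ∧ σ • x = x')
    (hρ : ∀ x : K →+* ℂ, (starRingAut : ℂ ≃+* ℂ) • (starRingAut : ℂ ≃+* ℂ) • x = x)
    (x : K →+* ℂ) (hx : x ≠ x₀) (hx' : x ≠ (starRingAut : ℂ ≃+* ℂ) • x₀) :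
    ∃ σ : ℂ ≃+* ℂ, σ • x₀ = x₀ ∧ σ • x = (starRingAut : ℂ ≃+* ℂ) • x :=
  htr x _ hx hx' (fun h => hx' (by rw [← h, hρ])) (fun h => hx (smul_left_cancel _ h))

/-- **Transitive stabilisers at one embedding ⟹ (SC) everywhere** (CM field form).
[cite: Wielandt1964, §16 and Thm. 28.4] -/
theorem stabConj_of_transitive {x₀ : K →+* ℂ}
    (htr : ∀ x x' : K →+* ℂ, x ≠ x₀ → x ≠ (starRingAut : ℂ ≃+* ℂ) • x₀ → x' ≠ x₀ →
      x' ≠ (starRingAut : ℂ ≃+* ℂ) • x₀ → ∃ σ : ℂ ≃+* ℂ, σ • x₀ = x₀ ∧ σ • x = x')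
    (x₁ x : K →+* ℂ) (hx : x ≠ x₁) (hx' : x ≠ (starRingAut : ℂ ≃+* ℂ) • x₁) :
    ∃ σ : ℂ ≃+* ℂ, σ • x₁ = x₁ ∧ σ • x = (starRingAut : ℂ ≃+* ℂ) • x :=
  stabConj_of_stabConj_at (stabConj_at_of_transitive htr conj_smul_conj_smul) x₁ x hx hx'

/-- **Transitive stabilisers ⟹ every CM type is nondegenerate** (e.g. `GL₂(𝔽₃)`-octic CM fields).
[cite: Shimura1998, §8.2 Prop. 26] [cite: Wielandt1964, Thm. 28.4] -/
theorem isNondegenerate_of_transitive {x₀ : K →+* ℂ}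
    (htr : ∀ x x' : K →+* ℂ, x ≠ x₀ → x ≠ (starRingAut : ℂ ≃+* ℂ) • x₀ → x' ≠ x₀ →
      x' ≠ (starRingAut : ℂ ≃+* ℂ) • x₀ → ∃ σ : ℂ ≃+* ℂ, σ • x₀ = x₀ ∧ σ • x = x')
    (Φ : CMType K) : IsNondegenerate Φ :=
  isNondegenerate_of_stabConj (stabConj_of_transitive htr) Φ

end Transitive

end Summit.HodgeConjecture.CorCM

end
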